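import Mathlib
import HarnessLib
import Summits.AtomisticToContinuum.FouriersLaw.Theses.JunctionLocality
import Summits.AtomisticToContinuum.FouriersLaw.Theorems.JunctionLocalitySuperadditiveResistanceDeviceLiouville

/-!
# Forward fields of the γ-probed device, IV: dissipativity — no `L²(μ_T)` solutions of
`(σ X_H + c S_B) w = λ w`, `λ > 0`
(helper toward stub `stub_deviceForwardFields` of line `floating-probe-bypass-laplacian`,
crux stmt-AtomisticToContinuum-11748; Part IV, see Part I `…StubDeviceForwardFieldsAux1` for the
overview)

`eq_zero_of_genOp_resolvent`: for the pinned chain (`ω₂ > 0`, `lam, β ≥ 0`), `T > 0`, site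
weights `B ≥ 0`, any `σ`, `c > 0` and `κ < 0`, every `w ∈ C² ∩ L²(μ_T)` with
`σ X_H w + c S_B w + κ w = 0` pointwise vanishes identically: testing the `μ_T`-conservativity of
`σ X_H + c S_B` against `φ(H/n) w²` gives `(−2κ) ∫ φ(H/n) w² dμ_T ≤ −c∫ w² S_B φ(H/n) + O(1/n)∫w²`
(the carré du champ is dropped after absorbing the cross term by AM–GM), and the right-hand side
tends to `0`. This is the injectivity of `λ − (σ X_H + c S_B)^†`-type operators on `L²(μ_T)`
(`λ = −κ > 0`), i.e. the density of the range of `λ − L` on `C_c^∞` — the essential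
m-dissipativity half of the construction of resolvent fields `(λ − L_dev)⁻¹(p_s² − T)`; no
thermostat needs to be active (`B = 0` allowed). Adapted line by line from
`partialP_eq_zero_of_genOp_eq_zero` (`…DeviceEnergy`, the case `κ = 0`). Axioms: `propext`,
`Classical.choice`, `Quot.sound`.
-/

noncomputable section

open MeasureTheory Filter Topology ProbabilityTheory
open scoped ContDiff NNReal
open Literature.MathematicalPhysics.KineticTheory.HeatConduction
open Summit.AtomisticToContinuum.FouriersLaw.Theorems.SuperadditiveResistance.DeviceLiouville

namespace Summit.AtomisticToContinuum.FouriersLaw.Cruxes.SuperadditiveResistance.FloatingProbeBypassLaplacian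

section Resolvent

variable {ω₂ lam β : ℝ} {L : ℕ}

/-- **Dissipativity: `(σ X_H + c S_B) w = λ w` has no nonzero `C² ∩ L²(μ_T)` solution for `λ > 0`.**
For the pinned chain (`ω₂ > 0`, `lam, β ≥ 0`), `T > 0`, weights `B ≥ 0`, any `σ`, `c > 0`,
`κ < 0`: a `C²`, `L²(μ_T)` pointwise solution of `σ X_H w + c S_B w + κ w = 0` is identically zero.
(adapted from `partialP_eq_zero_of_genOp_eq_zero`) [folklore] -/
theorem eq_zero_of_genOp_resolvent (hω : 0 < ω₂) (hl : 0 ≤ lam) (hβ : 0 ≤ β) (γ : ℝ)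
    (L : ℕ) {T : ℝ} (hT : 0 < T) (B : Fin L → ℝ) (hB : ∀ i, 0 ≤ B i) (σ : ℝ) {c : ℝ} (hc : 0 < c)
    {κ : ℝ} (hκ : κ < 0) {w : PhaseSpace L → ℝ} (hw : ContDiff ℝ 2 w)
    (hw2 : MemLp w 2 ((pinnedChain ω₂ lam β γ).gibbsMeasure L T))
    (hpde : ∀ x, σ * liouvilleOp (pinnedChain ω₂ lam β γ) L w x + c * bathOp L B T w x +
      κ * w x = 0)
    (x₀ : PhaseSpace L) : w x₀ = 0 := by
  -- the chain, its energy and Gibbs density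
  have hU1 : ContDiff ℝ 1 (pinnedChain ω₂ lam β γ).U := pinnedChain_contDiff_U ω₂ lam β γ
  have hV1 : ContDiff ℝ 1 (pinnedChain ω₂ lam β γ).V := pinnedChain_contDiff_V ω₂ lam β γ
  have hHs : ContDiff ℝ ∞ ((pinnedChain ω₂ lam β γ).hamiltonian L) :=
    (pinnedChain ω₂ lam β γ).contDiff_hamiltonian (pinnedChain_contDiff_U ω₂ lam β γ)
      (pinnedChain_contDiff_V ω₂ lam β γ) L
  have hHd : Differentiable ℝ ((pinnedChain ω₂ lam β γ).hamiltonian L) :=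
    hHs.differentiable (by simp)
  have hHc : Continuous ((pinnedChain ω₂ lam β γ).hamiltonian L) := hHd.continuous
  have hH0 : ∀ x, 0 ≤ (pinnedChain ω₂ lam β γ).hamiltonian L x := fun x =>
    pinnedChain_hamiltonian_nonneg hω.le hl hβ γ L x
  have hρc : Continuous ((pinnedChain ω₂ lam β γ).gibbsDensity L T) :=
    pinnedChain_continuous_gibbsDensity ω₂ lam β γ L T
  have hρpos : ∀ x, 0 < (pinnedChain ω₂ lam β γ).gibbsDensity L T x := fun x =>
    (pinnedChain ω₂ lam β γ).gibbsDensity_pos L T x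
  have hρint : Integrable ((pinnedChain ω₂ lam β γ).gibbsDensity L T) :=
    pinnedChain_integrable_gibbsDensity hω hl hβ γ L hT
  -- the profile
  obtain ⟨φ, K, hφs, hφ1, hφ0, hφnn, hφle, hK, hdsq, hdK, hddK, hd1, hd2⟩ := exists_profile
  have hφ2 : ContDiff ℝ 2 φ := hφs.of_le (by norm_cast)
  have hφd : Differentiable ℝ φ := hφ2.differentiable two_ne_zero
  have hφ'c : Continuous (deriv φ) := hφs.continuous_deriv (by simp)
  have hφ's : ContDiff ℝ ∞ (deriv φ) := hφs.deriv'
  have hφ''c : Continuous (deriv (deriv φ)) := hφ's.continuous_deriv (by simp)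
  -- regularity of w
  have hwd : Differentiable ℝ w := hw.differentiable two_ne_zero
  have hwc : Continuous w := hw.continuous
  have hac : ∀ j, Continuous (partialP j w) := fun j => continuous_partialP hw two_ne_zero j
  -- the cutoff family, radius n + 1
  have hr1 : ∀ n : ℕ, (1 : ℝ) ≤ (n : ℝ) + 1 := fun n => by
    have : (0 : ℝ) ≤ n := n.cast_nonneg
    linarith
  have hr0 : ∀ n : ℕ, (0 : ℝ) < (n : ℝ) + 1 := fun n => by positivity
  set η : ℕ → PhaseSpace L → ℝ := fun n => cutoff (pinnedChain ω₂ lam β γ) φ L ((n : ℝ) + 1)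
    with hηdef
  have hηs : ∀ n, ContDiff ℝ ∞ (η n) := fun n => contDiff_cutoff hφs hHs _
  have hη2 : ∀ n, ContDiff ℝ 2 (η n) := fun n => (hηs n).of_le (by norm_cast)
  have hηd : ∀ n, Differentiable ℝ (η n) := fun n => (hη2 n).differentiable two_ne_zero
  have hηc : ∀ n, Continuous (η n) := fun n => (hηd n).continuous
  have hηcs : ∀ n, HasCompactSupport (η n) := fun n =>
    HasCompactSupport.intro
      (pinnedChain_isCompact_setOf_hamiltonian_le hω hl hβ γ L (2 * ((n : ℝ) + 1)))
      (fun x hx => cutoff_eq_zero _ hφ0 (hr0 n) (hH0 x) (le_of_lt (not_le.mp hx)))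
  have hηnn : ∀ n x, 0 ≤ η n x := fun n x => cutoff_nonneg _ hφnn _ x
  have hη_one : ∀ (n : ℕ) (x : PhaseSpace L),
      (pinnedChain ω₂ lam β γ).hamiltonian L x ≤ (n : ℝ) + 1 → η n x = 1 := fun n x hx =>
    cutoff_eq_one _ hφ1 (hr0 n) (hH0 x) hx
  have hη_mono : ∀ m n : ℕ, 2 * ((m : ℝ) + 1) ≤ (n : ℝ) + 1 → ∀ x, η m x ≤ η n x :=
    fun m n hmn x => cutoff_le_cutoff _ hφ1 hφ0 hφnn hφle (hr0 m) hmn (hH0 x)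
  have hdηc : ∀ n j, Continuous (partialP j (η n)) := fun n j =>
    continuous_partialP (hη2 n) two_ne_zero j
  have hdη_sq : ∀ n j x, partialP j (η n) x ^ 2 ≤ 4 * K / ((n : ℝ) + 1) * η n x :=
    fun n j x => partialP_cutoff_sq_le hω.le hl hβ γ L hφd hK hφnn hdsq hd2 (hr1 n) j x
  have hbath_bd : ∀ n x, |bathOp L B T (η n) x| ≤ (∑ j, B j) * (K * (5 * T + 4)) :=
    fun n x => abs_bathOp_cutoff_le hω.le hl hβ γ L hφ2 hK hdK hddK hd2 B hB hT.le (hr1 n) x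
  have hbath_zero : ∀ (n : ℕ) (x : PhaseSpace L),
      (pinnedChain ω₂ lam β γ).hamiltonian L x < (n : ℝ) + 1 → bathOp L B T (η n) x = 0 :=
    fun n x hx => bathOp_cutoff_eq_zero _ hφ2 hd1 hHd B T (hr0 n) (hH0 x) hx
  have hlio_zero : ∀ n x, liouvilleOp (pinnedChain ω₂ lam β γ) L (η n) x = 0 := fun n x =>
    liouvilleOp_cutoff hφd hHd _ x
  have hbath_c : ∀ n, Continuous (bathOp L B T (η n)) := by
    intro n
    have : bathOp L B T (η n) = fun x => ∑ j, B j *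
        (T * (deriv (deriv φ) ((pinnedChain ω₂ lam β γ).hamiltonian L x / ((n : ℝ) + 1)) *
          (x.2 j / ((n : ℝ) + 1)) ^ 2 +
          deriv φ ((pinnedChain ω₂ lam β γ).hamiltonian L x / ((n : ℝ) + 1)) / ((n : ℝ) + 1)) -
          x.2 j * (deriv φ ((pinnedChain ω₂ lam β γ).hamiltonian L x / ((n : ℝ) + 1)) *
            (x.2 j / ((n : ℝ) + 1)))) :=
      funext fun x => bathOp_cutoff hφ2 hHd B T _ x
    rw [this]
    fun_prop
  -- `w² ρ` is Lebesgue integrable (this is where `w ∈ L²(μ_T)` enters)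
  have hint_w2 : Integrable (fun x => w x ^ 2 * (pinnedChain ω₂ lam β γ).gibbsDensity L T x) := by
    have h1 : Integrable (fun x => w x ^ 2) ((pinnedChain ω₂ lam β γ).gibbsMeasure L T) :=
      hw2.integrable_sq
    rw [OscillatorChain.gibbsMeasure_eq, integrable_tilted_iff hρint] at h1
    refine h1.congr (ae_of_all _ fun x => ?_)
    simp only [smul_eq_mul, OscillatorChain.exp_neg_hamiltonian_div]
    ring
  -- the error functional
  set kk : ℕ → ℝ := fun n => 4 * K / ((n : ℝ) + 1) with hkkdef
  have hkk0 : ∀ n, 0 ≤ kk n := fun n => by positivity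
  have hkkle : ∀ n, kk n ≤ 4 * K := fun n => div_le_self (by positivity) (hr1 n)
  set g : ℕ → PhaseSpace L → ℝ := fun n x =>
    (-(c * (w x ^ 2 * bathOp L B T (η n) x)) + 4 * c * T * kk n * (∑ j, B j) * w x ^ 2) *
      (pinnedChain ω₂ lam β γ).gibbsDensity L T x with hgdef
  have hgc : ∀ n, Continuous (g n) := fun n => by
    simp only [hgdef]
    fun_prop
  have hg_int : ∀ n, Integrable (g n) := by
    intro n
    have h1 : Integrable (fun x => bathOp L B T (η n) x *
        (w x ^ 2 * (pinnedChain ω₂ lam β γ).gibbsDensity L T x)) :=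
      hint_w2.bdd_mul (hbath_c n).aestronglyMeasurable
        (ae_of_all _ fun x => by rw [Real.norm_eq_abs]; exact hbath_bd n x)
    have h2 := (h1.const_mul (-c)).add (hint_w2.const_mul (4 * c * T * kk n * ∑ j, B j))
    refine h2.congr (ae_of_all _ fun x => ?_)
    simp only [hgdef, Pi.add_apply]
    ring
  -- STEP 1: the dissipation inequality at level n
  have step1 : ∀ n : ℕ, (-2 * κ) * ∫ x, η n x * w x ^ 2 *
      (pinnedChain ω₂ lam β γ).gibbsDensity L T x ≤ ∫ x, g n x := by
    intro n
    -- the test function F = η w²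
    have hF2 : ContDiff ℝ 2 (fun y => η n y * w y ^ 2) := (hη2 n).mul (hw.pow 2)
    have hFc : HasCompactSupport (fun y => η n y * w y ^ 2) := (hηcs n).mul_right
    have hzero := integral_genOp_mul_gibbsDensity (pinnedChain ω₂ lam β γ) hU1 hV1 L B hT.ne' σ c
      hF2 hFc
    -- pointwise expansion of the generator on F
    have hpt : ∀ x, σ * liouvilleOp (pinnedChain ω₂ lam β γ) L (fun y => η n y * w y ^ 2) x +
        c * bathOp L B T (fun y => η n y * w y ^ 2) x =
        c * (w x ^ 2 * bathOp L B T (η n) x + ∑ j, B j * (2 * T * η n x * partialP j w x ^ 2 +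
          4 * T * partialP j (η n) x * w x * partialP j w x)) - 2 * κ * (η n x * w x ^ 2) := by
      intro x
      rw [liouvilleOp_mul_sq (hηd n) hwd, bathOp_mul_sq (hη2 n) hw, hlio_zero]
      linear_combination (2 * η n x * w x) * hpde x
    -- the integrable upper function and its vanishing integral
    set U : PhaseSpace L → ℝ := fun x => (c * (w x ^ 2 * bathOp L B T (η n) x +
      ∑ j, B j * (2 * T * η n x * partialP j w x ^ 2 +
        4 * T * partialP j (η n) x * w x * partialP j w x)) - 2 * κ * (η n x * w x ^ 2)) *
          (pinnedChain ω₂ lam β γ).gibbsDensity L T x with hUdef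
    have hU0 : ∫ x, U x = 0 := by
      rw [← hzero]
      refine integral_congr_ae (ae_of_all _ fun x => ?_)
      simp only [hUdef]
      rw [hpt x]
    have hηw2 : Integrable (fun x => η n x * w x ^ 2 * (pinnedChain ω₂ lam β γ).gibbsDensity L T x) :=
      Continuous.integrable_of_hasCompactSupport (by fun_prop) ((hηcs n).mul_right.mul_right)
    have hUint : Integrable U := by
      have h1 : Integrable (fun x => bathOp L B T (η n) x *
          (w x ^ 2 * (pinnedChain ω₂ lam β γ).gibbsDensity L T x)) :=
        hint_w2.bdd_mul (hbath_c n).aestronglyMeasurable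
          (ae_of_all _ fun x => by rw [Real.norm_eq_abs]; exact hbath_bd n x)
      have h2 : ∀ j, Integrable (fun x => B j * (2 * T * η n x * partialP j w x ^ 2 +
          4 * T * partialP j (η n) x * w x * partialP j w x) *
            (pinnedChain ω₂ lam β γ).gibbsDensity L T x) := by
        intro j
        have h3 : Integrable (fun x => η n x * (partialP j w x ^ 2 *
            (pinnedChain ω₂ lam β γ).gibbsDensity L T x)) :=
          Continuous.integrable_of_hasCompactSupport (by fun_prop) (hηcs n).mul_right
        have h4 : Integrable (fun x => partialP j (η n) x * (w x * partialP j w x *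
            (pinnedChain ω₂ lam β γ).gibbsDensity L T x)) :=
          Continuous.integrable_of_hasCompactSupport (by fun_prop)
            (hasCompactSupport_partialP (hηd n) (hηcs n) j).mul_right
        have h5 := (h3.const_mul (B j * (2 * T))).add (h4.const_mul (B j * (4 * T)))
        refine h5.congr (ae_of_all _ fun x => ?_)
        simp only [Pi.add_apply]
        ring
      have h1' : Integrable (fun x => w x ^ 2 * bathOp L B T (η n) x *
          (pinnedChain ω₂ lam β γ).gibbsDensity L T x) :=
        h1.congr (ae_of_all _ fun x => by ring)
      have hS : Integrable (fun x => (∑ j, B j * (2 * T * η n x * partialP j w x ^ 2 +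
          4 * T * partialP j (η n) x * w x * partialP j w x)) *
            (pinnedChain ω₂ lam β γ).gibbsDensity L T x) :=
        (integrable_finsetSum Finset.univ fun j _ => h2 j).congr
          (ae_of_all _ fun x => by simp only [Finset.sum_mul])
      have h6 := ((h1'.add hS).const_mul c).sub (hηw2.const_mul (2 * κ))
      refine h6.congr (ae_of_all _ fun x => ?_)
      simp only [hUdef, Pi.add_apply, Pi.sub_apply]
      ring
    -- the lower function
    set Lo : PhaseSpace L → ℝ := fun x => (-2 * κ) * (η n x * w x ^ 2 *
      (pinnedChain ω₂ lam β γ).gibbsDensity L T x) - g n x with hLodef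
    have hLoint : Integrable Lo := (hηw2.const_mul _).sub (hg_int n)
    have hLoU : ∀ x, Lo x ≤ U x := by
      intro x
      simp only [hLodef, hUdef, hgdef]
      have hsum : ∑ j, B j * (T * η n x * partialP j w x ^ 2 - 4 * T * kk n * w x ^ 2) ≤
          ∑ j, B j * (2 * T * η n x * partialP j w x ^ 2 +
            4 * T * partialP j (η n) x * w x * partialP j w x) :=
        Finset.sum_le_sum fun j _ => mul_le_mul_of_nonneg_left
          (amgm_aux hT.le (hηnn n x) (hkk0 n) (hdη_sq n j x)) (hB j)
      have hpos : 0 ≤ ∑ j, B j * (T * η n x * partialP j w x ^ 2) :=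
        Finset.sum_nonneg fun j _ => mul_nonneg (hB j) (by have := hηnn n x; positivity)
      have e1 : ∑ j, B j * (T * η n x * partialP j w x ^ 2 - 4 * T * kk n * w x ^ 2) =
          ∑ j, B j * (T * η n x * partialP j w x ^ 2) - 4 * T * kk n * w x ^ 2 * ∑ j, B j := by
        rw [Finset.mul_sum, ← Finset.sum_sub_distrib]
        refine Finset.sum_congr rfl fun j _ => ?_
        ring
      have key : -(4 * T * kk n * (∑ j, B j) * w x ^ 2) ≤
          ∑ j, B j * (2 * T * η n x * partialP j w x ^ 2 +
            4 * T * partialP j (η n) x * w x * partialP j w x) := by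
        nlinarith [hpos, hsum, e1]
      have key2 : 0 ≤ c * (pinnedChain ω₂ lam β γ).gibbsDensity L T x *
          ((∑ j, B j * (2 * T * η n x * partialP j w x ^ 2 +
            4 * T * partialP j (η n) x * w x * partialP j w x)) +
            4 * T * kk n * (∑ j, B j) * w x ^ 2) :=
        mul_nonneg (mul_nonneg hc.le (hρpos x).le) (by linarith)
      rw [← sub_nonneg]
      have hdiff : (c * (w x ^ 2 * bathOp L B T (η n) x +
          ∑ j, B j * (2 * T * η n x * partialP j w x ^ 2 +
            4 * T * partialP j (η n) x * w x * partialP j w x)) - 2 * κ * (η n x * w x ^ 2)) *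
            (pinnedChain ω₂ lam β γ).gibbsDensity L T x -
          ((-2 * κ) * (η n x * w x ^ 2 * (pinnedChain ω₂ lam β γ).gibbsDensity L T x) -
            (-(c * (w x ^ 2 * bathOp L B T (η n) x)) + 4 * c * T * kk n * (∑ j, B j) * w x ^ 2) *
              (pinnedChain ω₂ lam β γ).gibbsDensity L T x) =
          c * (pinnedChain ω₂ lam β γ).gibbsDensity L T x *
          ((∑ j, B j * (2 * T * η n x * partialP j w x ^ 2 +
            4 * T * partialP j (η n) x * w x * partialP j w x)) +
            4 * T * kk n * (∑ j, B j) * w x ^ 2) := by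
        ring
      rw [hdiff]
      exact key2
    have hmono := integral_mono hLoint hUint hLoU
    rw [hU0] at hmono
    have hsplit : ∫ x, Lo x = ((-2 * κ) * ∫ x, η n x * w x ^ 2 *
        (pinnedChain ω₂ lam β γ).gibbsDensity L T x) - ∫ x, g n x := by
      simp only [hLodef]
      rw [integral_sub (hηw2.const_mul _) (hg_int n), integral_const_mul]
    rw [hsplit] at hmono
    linarith
  -- STEP 2: the error functional tends to zero (dominated convergence)
  have step2 : Tendsto (fun n => ∫ x, g n x) atTop (𝓝 0) := by
    have hbound : ∀ n x, ‖g n x‖ ≤ (c * ((∑ j, B j) * (K * (5 * T + 4))) +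
        4 * c * T * (4 * K) * (∑ j, B j)) * (w x ^ 2 * (pinnedChain ω₂ lam β γ).gibbsDensity L T x) := by
      intro n x
      rw [Real.norm_eq_abs, hgdef]
      simp only
      have hB0 : 0 ≤ ∑ j, B j := Finset.sum_nonneg fun j _ => hB j
      have hwρ : 0 ≤ w x ^ 2 * (pinnedChain ω₂ lam β γ).gibbsDensity L T x :=
        mul_nonneg (sq_nonneg _) (hρpos x).le
      have h1 : |-(c * (w x ^ 2 * bathOp L B T (η n) x))| ≤
          c * ((∑ j, B j) * (K * (5 * T + 4))) * w x ^ 2 := by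
        rw [abs_neg, abs_mul, abs_mul, abs_of_pos hc, abs_of_nonneg (sq_nonneg _)]
        have h1' : w x ^ 2 * |bathOp L B T (η n) x| ≤ w x ^ 2 * ((∑ j, B j) * (K * (5 * T + 4))) :=
          mul_le_mul_of_nonneg_left (hbath_bd n x) (sq_nonneg _)
        have h1'' := mul_le_mul_of_nonneg_left h1' hc.le
        linarith [h1'']
      have h2 : |4 * c * T * kk n * (∑ j, B j) * w x ^ 2| ≤ 4 * c * T * (4 * K) * (∑ j, B j) * w x ^ 2 := by
        rw [abs_of_nonneg (by have := hkk0 n; positivity)]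
        have := hkkle n
        gcongr
      rw [abs_mul, abs_of_nonneg (hρpos x).le]
      have h3 := abs_add_le (-(c * (w x ^ 2 * bathOp L B T (η n) x)))
        (4 * c * T * kk n * (∑ j, B j) * w x ^ 2)
      have hρ0 := (hρpos x).le
      nlinarith [mul_le_mul_of_nonneg_right (h3.trans (add_le_add h1 h2)) hρ0]
    have hlim : ∀ x, Tendsto (fun n => g n x) atTop (𝓝 0) := by
      intro x
      obtain ⟨N, hN⟩ := exists_nat_gt ((pinnedChain ω₂ lam β γ).hamiltonian L x)
      have hev : (fun n => g n x) =ᶠ[atTop] fun n =>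
          4 * c * T * (∑ j, B j) * (w x ^ 2 * (pinnedChain ω₂ lam β γ).gibbsDensity L T x) *
            (4 * K) * (1 / ((n : ℝ) + 1)) := by
        filter_upwards [Filter.eventually_ge_atTop N] with n hn
        have hn' : (pinnedChain ω₂ lam β γ).hamiltonian L x < (n : ℝ) + 1 := by
          have : (N : ℝ) ≤ n := by exact_mod_cast hn
          linarith
        rw [hgdef]
        simp only [hbath_zero n x hn', mul_zero, neg_zero, zero_add, hkkdef]
        ring
      rw [tendsto_congr' hev]
      have := (tendsto_one_div_add_atTop_nhds_zero_nat (𝕜 := ℝ)).const_mul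
        (4 * c * T * (∑ j, B j) * (w x ^ 2 * (pinnedChain ω₂ lam β γ).gibbsDensity L T x) * (4 * K))
      simpa using this
    have := tendsto_integral_of_dominated_convergence
      (fun x => (c * ((∑ j, B j) * (K * (5 * T + 4))) + 4 * c * T * (4 * K) * (∑ j, B j)) *
        (w x ^ 2 * (pinnedChain ω₂ lam β γ).gibbsDensity L T x))
      (fun n => (hgc n).aestronglyMeasurable) (hint_w2.const_mul _)
      (fun n => ae_of_all _ (hbound n)) (ae_of_all _ hlim)
    simpa using this
  -- STEP 3: conclusion at x₀
  obtain ⟨m, hm0⟩ := exists_nat_ge ((pinnedChain ω₂ lam β γ).hamiltonian L x₀)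
  have hm : (pinnedChain ω₂ lam β γ).hamiltonian L x₀ ≤ (m : ℝ) + 1 := hm0.trans (by linarith)
  have hIm_int : Integrable (fun x => η m x * w x ^ 2 *
      (pinnedChain ω₂ lam β γ).gibbsDensity L T x) :=
    Continuous.integrable_of_hasCompactSupport (by fun_prop) ((hηcs m).mul_right.mul_right)
  have hIm_le : (-2 * κ) * ∫ x, η m x * w x ^ 2 *
      (pinnedChain ω₂ lam β γ).gibbsDensity L T x ≤ 0 := by
    refine ge_of_tendsto step2 ?_
    filter_upwards [Filter.eventually_ge_atTop (2 * m + 1)] with n hn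
    have hmn : 2 * ((m : ℝ) + 1) ≤ (n : ℝ) + 1 := by
      have : ((2 * m + 1 : ℕ) : ℝ) ≤ n := by exact_mod_cast hn
      push_cast at this
      linarith
    have hIn_int : Integrable (fun x => η n x * w x ^ 2 *
        (pinnedChain ω₂ lam β γ).gibbsDensity L T x) :=
      Continuous.integrable_of_hasCompactSupport (by fun_prop) ((hηcs n).mul_right.mul_right)
    have hmono : ∫ x, η m x * w x ^ 2 * (pinnedChain ω₂ lam β γ).gibbsDensity L T x ≤
        ∫ x, η n x * w x ^ 2 * (pinnedChain ω₂ lam β γ).gibbsDensity L T x :=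
      integral_mono hIm_int hIn_int fun x => mul_le_mul_of_nonneg_right
        (mul_le_mul_of_nonneg_right (hη_mono m n hmn x) (sq_nonneg _)) (hρpos x).le
    have := step1 n
    have h2κ : 0 ≤ -2 * κ := by linarith
    nlinarith [mul_le_mul_of_nonneg_left hmono h2κ]
  have h2κ : 0 < -2 * κ := by linarith
  have hIm_zero : ∫ x, η m x * w x ^ 2 *
      (pinnedChain ω₂ lam β γ).gibbsDensity L T x = 0 := by
    have hnn : 0 ≤ ∫ x, η m x * w x ^ 2 * (pinnedChain ω₂ lam β γ).gibbsDensity L T x :=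
      integral_nonneg fun x => mul_nonneg (mul_nonneg (hηnn m x) (sq_nonneg _)) (hρpos x).le
    have : ∫ x, η m x * w x ^ 2 * (pinnedChain ω₂ lam β γ).gibbsDensity L T x ≤ 0 := by
      by_contra h
      push Not at h
      have := mul_pos h2κ h
      linarith
    linarith
  rw [integral_eq_zero_iff_of_nonneg (fun x => mul_nonneg (mul_nonneg (hηnn m x) (sq_nonneg _))
    (hρpos x).le) hIm_int] at hIm_zero
  haveI := isAddHaarMeasure_volume_phaseSpace L
  have hfun : (fun x => η m x * w x ^ 2 * (pinnedChain ω₂ lam β γ).gibbsDensity L T x) =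
      fun _ => 0 :=
    (Continuous.ae_eq_iff_eq volume (by fun_prop) continuous_const).mp hIm_zero
  have hx₀ := congr_fun hfun x₀
  simp only [hη_one m x₀ hm, one_mul, mul_eq_zero, (hρpos x₀).ne', or_false] at hx₀
  exact pow_eq_zero_iff two_ne_zero |>.mp hx₀


end Resolvent

/-- Registered helper sub-goal `helper_dffResolventDissipative` of stub `stub_deviceForwardFields`: dissipativity of `σ X_H + c S_B` (= `eq_zero_of_genOp_resolvent` in stub form). [folklore] -/
theorem helper_dffResolventDissipative : ∀ (ω₂ lam β γ : ℝ), 0 < ω₂ → 0 ≤ lam → 0 ≤ β → ∀ (L : ℕ) (T : ℝ), 0 < T → ∀ (B : Fin L → ℝ), (∀ i, 0 ≤ B i) → ∀ (σ c : ℝ), 0 < c → ∀ (κ : ℝ), κ < 0 → ∀ (w : PhaseSpace L → ℝ), ContDiff ℝ 2 w → MemLp w 2 ((pinnedChain ω₂ lam β γ).gibbsMeasure L T) → (∀ x, σ * Summit.AtomisticToContinuum.FouriersLaw.Theorems.SuperadditiveResistance.DeviceLiouville.liouvilleOp (pinnedChain ω₂ lam β γ) L w x + c * Summit.AtomisticToContinuum.FouriersLaw.Theorems.SuperadditiveResistance.DeviceLiouville.bathOp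 L B T w x + κ * w x = 0) → ∀ x : PhaseSpace L, w x = 0 :=
  fun _ _ _ γ hω hl hβ L _ hT B hB σ _ hc _ hκ _ hw hw2 hpde x => eq_zero_of_genOp_resolvent hω hl hβ γ L hT B hB σ hc hκ hw hw2 hpde x

end Summit.AtomisticToContinuum.FouriersLaw.Cruxes.SuperadditiveResistance.FloatingProbeBypassLaplacian

end
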